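import Literature.NumberTheory.Sieve.SmoothSaddlePointPhiHigher
import Literature.NumberTheory.Sieve.SaddleWindowSecondOrder
import Literature.NumberTheory.Sieve.SmoothRieszMeanKernel
import HarnessLib

/-!
# Hildebrand–Tenenbaum's Lemma 11, window part, at the precision `1 + O(1/ū)` — uniformly in `x ≥ y ≥ 2`

Topic `Literature/NumberTheory/Sieve`; a PROVED tool toward Hildebrand–Tenenbaum's saddle-point theorem
`Ψ(x, y) = x^α ζ(α, y)/(α √(2π φ₂(α, y))) (1 + O(1/u + log y/y))` [HildebrandTenenbaum1986, Thm 1].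
With `α = α(x, y)`, `φ = φ₂(α, y)`, `Φ₃ = -φ₃(α, y)`, `Φ₄ = φ₄(α, y)` (`SmoothSaddlePointPhiHigher`) and the
saddle exponent `e(t) = φ(α + it, y) - φ(α, y) + it log x` (`SmoothRieszMeanKernel.saddleExponent`,
`exp e(t) = ζ(α + it, y) x^{it}/ζ(α, y)`):

* `norm_saddleExponent_taylor_four` — the FOURTH-order Taylor remainder
  `‖e(t) + φt²/2 - iΦ₃t³/6‖ ≤ Φ₄ t⁴` for ALL real `t` and all `x > 1`, `y ≥ 2` (no restriction on `α`:
  three mean value inequalities from `‖φ₃(α + iu, y) - φ₃(α, y)‖ ≤ |u| φ₄(α, y)`), refining the tree's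
  second-order `norm_saddleExponent_add_le` (`‖e(t) + φt²/2‖ ≤ 13τ³ log y · φ`, `α ≥ 3/5` only);
* `SaddleWindow.norm_inv_sub_taylor_le`, `SaddleWindow.norm_inv_mul_inv_sub_taylor_le` — the Perron
  kernel `1/s` and the Riesz kernel `1/(s(s+1))` at second order on `s = α + it`:
  `‖1/s - 1/α + it/α²‖ ≤ t²/α³`, `‖1/(s(s+1)) - A₀ - A₁t‖ ≤ 2t²/α³`;
* `norm_setIntegral_window_saddle_sub_main_le` — for any continuous kernel `A` with
  `‖A(t) - A₀ - A₁t‖ ≤ B₂t²` on the window `|t| ≤ τ`, `Φ₃τ³/6 + Φ₄τ⁴ ≤ 1`: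
  `‖∫_{[-τ,τ]} exp(e(t)) A(t) dt - A₀ √(2π/φ)‖ ≤ ‖A₀‖ e^{-φτ²/4} √(4π/φ)`
  `  + √(4π/φ) (eB₂ (4/(eφ)) + (‖A₀‖Φ₄ + ‖A₁‖(Φ₃/3 + Φ₄))(8/(eφ))² + (‖A₀‖Φ₃²/18 + ‖A₁‖Φ₄)(12/(eφ))³`
  `  + 2‖A₀‖Φ₄² (16/(eφ))⁴)`
  (`SaddleWindow.norm_window_pointwise` + `SaddleWindow.norm_setIntegral_window_sub_main_le`: the odd
  terms `iΦ₃t³/6` and `A₁t` integrate to zero). With Lemma 4 (`Φ₃ ≍ φ^{3/2}ū^{-1/2}`, `Φ₄ ≍ φ²/ū`,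
  `exists_saddlePhi₃_saddlePoint_le_uniform`, `exists_saddlePhi₄_saddlePoint_le_uniform`,
  `le_saddlePhi₂_saddlePoint_uniform`) and `‖A₁‖/‖A₀‖ ≍ 1/α`, `B₂/‖A₀‖ ≍ 1/α²`, every error term is
  `O(‖A₀‖ φ^{-1/2} (1/ū + 1/(α²φ)))` = `O(‖A₀‖ φ^{-1/2}/ū)` — the window contribution to (2.3).

NOT here: the ranges `τ ≤ |t| ≤ π/log y` (Lemma 8 (i)) and `|t| ≥ π/log y` (Lemma 8 (ii), the deep input),
and the passage from the Perron/Riesz integral to `Ψ(x, y)` (Lemma 9–10).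

## References

* [HildebrandTenenbaum1986] A. Hildebrand, G. Tenenbaum, Trans. AMS 296 (1986) 265–290, §4, Lemma 11
  and (4.3)–(4.8) (held: `paper:doi-10-1090-s0002-9947-1986-0837811-1`, pp. 279–282).
-/

noncomputable section

open Real Complex MeasureTheory Set Filter

namespace Literature.NumberTheory.Sieve

/-! ### The Perron and Riesz kernels at second order -/

namespace SaddleWindow

variable {α t : ℝ}

/-- `‖α + it‖ ≥ α` for real `α ≥ 0`, `t`. [folklore] -/
theorem le_norm_add_mul_I (hα : 0 ≤ α) (t : ℝ) : α ≤ ‖(α : ℂ) + t * I‖ := by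
  have h : ((α : ℂ) + t * I).re = α := by simp
  calc α = |((α : ℂ) + t * I).re| := by rw [h, abs_of_nonneg hα]
    _ ≤ ‖(α : ℂ) + t * I‖ := Complex.abs_re_le_norm _

/-- `α + it ≠ 0` for `α > 0`. [folklore] -/
theorem add_mul_I_ne_zero (hα : 0 < α) (t : ℝ) : (α : ℂ) + t * I ≠ 0 := by
  intro h
  have := congrArg Complex.re h
  simp at this
  linarith

/-- **The sharp Perron kernel at second order**: for `α > 0` and all real `t`,
`‖1/(α + it) - 1/α - (-i/α²) t‖ = t²/(α² |α + it|) ≤ t²/α³`. [folklore] -/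
theorem norm_inv_sub_taylor_le (hα : 0 < α) (t : ℝ) :
    ‖((α : ℂ) + t * I)⁻¹ - (α : ℂ)⁻¹ - (-I / (α : ℂ) ^ 2) * t‖ ≤ t ^ 2 / α ^ 3 := by
  have hs := add_mul_I_ne_zero hα t
  have hαC : (α : ℂ) ≠ 0 := by exact_mod_cast hα.ne'
  have hid : ((α : ℂ) + t * I)⁻¹ - (α : ℂ)⁻¹ - (-I / (α : ℂ) ^ 2) * t =
      -((t : ℂ) ^ 2) / ((α : ℂ) ^ 2 * ((α : ℂ) + t * I)) := by
    field_simp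
    ring_nf
    simp only [Complex.I_sq]
    ring
  rw [hid, norm_div, norm_neg, norm_pow, norm_mul, norm_pow, Complex.norm_real, Complex.norm_real,
    Real.norm_eq_abs, Real.norm_eq_abs, abs_of_pos hα, sq_abs]
  have hn := le_norm_add_mul_I hα.le t
  have hn0 : 0 < ‖(α : ℂ) + t * I‖ := lt_of_lt_of_le hα hn
  rw [div_le_div_iff₀ (by positivity) (by positivity)]
  calc t ^ 2 * α ^ 3 = t ^ 2 * α ^ 2 * α := by ring
    _ ≤ t ^ 2 * α ^ 2 * ‖(α : ℂ) + t * I‖ := mul_le_mul_of_nonneg_left hn (by positivity)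
    _ = t ^ 2 * (α ^ 2 * ‖(α : ℂ) + t * I‖) := by ring

/-- **The Riesz kernel `1/(s(s+1))` at second order** (`s = α + it`, `α > 0`): with
`A₀ = 1/α - 1/(α+1) = 1/(α(α+1))` and `A₁ = -i/α² + i/(α+1)²`,
`‖1/(s(s+1)) - A₀ - A₁ t‖ ≤ 2t²/α³` (partial fractions `1/(s(s+1)) = 1/s - 1/(s+1)`). [folklore] -/
theorem norm_inv_mul_inv_sub_taylor_le (hα : 0 < α) (t : ℝ) :
    ‖(((α : ℂ) + t * I) * ((α : ℂ) + t * I + 1))⁻¹ - ((α : ℂ)⁻¹ - ((α + 1 : ℝ) : ℂ)⁻¹) -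
        (-I / (α : ℂ) ^ 2 + I / ((α + 1 : ℝ) : ℂ) ^ 2) * t‖ ≤ 2 * t ^ 2 / α ^ 3 := by
  have hα1 : 0 < α + 1 := by linarith
  have hs := add_mul_I_ne_zero hα t
  have hs1 := add_mul_I_ne_zero hα1 t
  have hs1' : (α : ℂ) + t * I + 1 = ((α + 1 : ℝ) : ℂ) + t * I := by push_cast; ring
  have hpf : (((α : ℂ) + t * I) * ((α : ℂ) + t * I + 1))⁻¹ =
      ((α : ℂ) + t * I)⁻¹ - (((α + 1 : ℝ) : ℂ) + t * I)⁻¹ := by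
    rw [hs1']
    field_simp
    push_cast
    ring
  have h1 := norm_inv_sub_taylor_le hα t
  have h2 := norm_inv_sub_taylor_le hα1 t
  have hid : (((α : ℂ) + t * I) * ((α : ℂ) + t * I + 1))⁻¹ - ((α : ℂ)⁻¹ - ((α + 1 : ℝ) : ℂ)⁻¹) -
      (-I / (α : ℂ) ^ 2 + I / ((α + 1 : ℝ) : ℂ) ^ 2) * t =
      (((α : ℂ) + t * I)⁻¹ - (α : ℂ)⁻¹ - (-I / (α : ℂ) ^ 2) * t) -
        ((((α + 1 : ℝ) : ℂ) + t * I)⁻¹ - ((α + 1 : ℝ) : ℂ)⁻¹ - (-I / ((α + 1 : ℝ) : ℂ) ^ 2) * t) := by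
    rw [hpf]; ring
  rw [hid]
  have h3 : t ^ 2 / (α + 1) ^ 3 ≤ t ^ 2 / α ^ 3 := by
    apply div_le_div_of_nonneg_left (sq_nonneg t) (by positivity)
    exact pow_le_pow_left₀ hα.le (by linarith) 3
  calc _ ≤ ‖((α : ℂ) + t * I)⁻¹ - (α : ℂ)⁻¹ - (-I / (α : ℂ) ^ 2) * t‖ +
        ‖(((α + 1 : ℝ) : ℂ) + t * I)⁻¹ - ((α + 1 : ℝ) : ℂ)⁻¹ - (-I / ((α + 1 : ℝ) : ℂ) ^ 2) * t‖ :=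
        norm_sub_le _ _
    _ ≤ t ^ 2 / α ^ 3 + t ^ 2 / (α + 1) ^ 3 := add_le_add h1 h2
    _ ≤ 2 * t ^ 2 / α ^ 3 := by rw [two_mul, add_div]; gcongr

end SaddleWindow

/-! ### The fourth-order Taylor remainder of the saddle exponent -/

variable {x α t τ : ℝ} {y : ℕ} {z : ℂ}

/-- **`e'''`**: `(d/dz)(-φ₂(α + iz, y)) = -φ₃(α + iz, y) · i = smoothPhi₃ (α + iz) y · i`
whenever `Re(α + iz) > 0`. [folklore] -/
theorem hasDerivAt_neg_smoothPhi₂_line (hz : 0 < ((α : ℂ) + z * I).re) :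
    HasDerivAt (fun w : ℂ => -smoothPhi₂ ((α : ℂ) + w * I) y) (smoothPhi₃ ((α : ℂ) + z * I) y * I) z := by
  have h1 : HasDerivAt (fun w : ℂ => smoothPhi₂ ((α : ℂ) + w * I) y) (-smoothPhi₃ ((α : ℂ) + z * I) y * I) z :=
    HasDerivAt.comp (h₂ := fun s : ℂ => smoothPhi₂ s y) z (hasDerivAt_smoothPhi₂ hz y)
      (hasDerivAt_add_mul_I α z)
  refine h1.neg.congr_deriv ?_
  ring

/-- On `uIcc 0 t`, `|u| ≤ |t|`. [folklore] -/
theorem abs_le_abs_of_mem_uIcc {u t : ℝ} (hu : u ∈ Set.uIcc (0 : ℝ) t) : |u| ≤ |t| := by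
  rcases Set.mem_uIcc.1 hu with ⟨h0, h1⟩ | ⟨h0, h1⟩
  · rw [abs_of_nonneg h0]; exact le_trans h1 (le_abs_self t)
  · rw [abs_of_nonpos h1]; linarith [neg_le_abs t]

/-- **The saddle exponent to fourth order, uniformly**: with `α = α(x, y)` (`x > 1`, `y ≥ 2`),
`φ = φ₂(α, y)`, `Φ₃ = -φ₃(α, y)`, `Φ₄ = φ₄(α, y)`, for every real `t`:
`‖e(t) + φt²/2 - iΦ₃t³/6‖ ≤ Φ₄ t⁴`. With `K(u) = e(u) + φu²/2 - iΦ₃u³/6` one has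
`K(0) = K'(0) = K''(0) = 0` (the saddle-point condition gives `e'(0) = 0`) and
`‖K'''(u)‖ = ‖φ₃(α+iu, y) - φ₃(α, y)‖ ≤ |u| Φ₄`; three mean value inequalities on `[0, t]`.
[cite: HildebrandTenenbaum1986, §4 (4.5)–(4.6)] -/
theorem norm_saddleExponent_taylor_four (hx : 1 < x) (hy : 2 ≤ y) (t : ℝ) :
    ‖saddleExponent x (saddlePoint x y) y t +
        ((saddlePhi₂ (saddlePoint x y) y / 2 * t ^ 2 : ℝ) : ℂ) -
        ((saddlePhi₃ (saddlePoint x y) y / 6 * t ^ 3 : ℝ) : ℂ) * I‖ ≤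
      saddlePhi₄ (saddlePoint x y) y * t ^ 4 := by
  set α : ℝ := saddlePoint x y with hαdef
  have hα0 : 0 < α := saddlePoint_pos hx hy
  set φ : ℝ := saddlePhi₂ α y with hφ
  set Φ₃ : ℝ := saddlePhi₃ α y with hΦ₃
  set Φ₄ : ℝ := saddlePhi₄ α y with hΦ₄
  have hΦ₄0 : 0 ≤ Φ₄ := saddlePhi₄_nonneg hα0 y
  -- the corrected functions of a real variable
  set e : ℝ → ℂ := fun u => saddleExponent x α y u with he
  set e' : ℝ → ℂ := fun u => saddleExponentDeriv x α y u with he'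
  set K : ℝ → ℂ := fun u => e u + ((φ / 2 * u ^ 2 : ℝ) : ℂ) - ((Φ₃ / 6 * u ^ 3 : ℝ) : ℂ) * I with hK
  set K' : ℝ → ℂ := fun u => e' u + ((φ * u : ℝ) : ℂ) - ((Φ₃ / 2 * u ^ 2 : ℝ) : ℂ) * I with hK'
  set K'' : ℝ → ℂ := fun u => -smoothPhi₂ ((α : ℂ) + u * I) y + (φ : ℂ) - ((Φ₃ * u : ℝ) : ℂ) * I with hK''
  set K''' : ℝ → ℂ := fun u => smoothPhi₃ ((α : ℂ) + u * I) y * I - (Φ₃ : ℂ) * I with hK'''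
  have hre : ∀ u : ℝ, 0 < ((α : ℂ) + (u : ℂ) * I).re := fun u => by simp [hα0]
  -- derivatives along the real axis
  have hKd : ∀ u : ℝ, HasDerivAt K (K' u) u := by
    intro u
    have h1 : HasDerivAt e (e' u) u := (hasDerivAt_saddleExponent (hre u)).comp_ofReal
    have h2 : HasDerivAt (fun u : ℝ => ((φ / 2 * u ^ 2 : ℝ) : ℂ)) ((φ * u : ℝ) : ℂ) u := by
      have h := ((hasDerivAt_pow 2 u).const_mul (φ / 2)).ofReal_comp
      refine h.congr_deriv ?_
      push_cast; ring
    have h3 : HasDerivAt (fun u : ℝ => ((Φ₃ / 6 * u ^ 3 : ℝ) : ℂ) * I) (((Φ₃ / 2 * u ^ 2 : ℝ) : ℂ) * I) u := by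
      have h := (((hasDerivAt_pow 3 u).const_mul (Φ₃ / 6)).ofReal_comp).mul_const I
      refine h.congr_deriv ?_
      push_cast; ring
    exact (h1.add h2).sub h3
  have hK'd : ∀ u : ℝ, HasDerivAt K' (K'' u) u := by
    intro u
    have h1 : HasDerivAt e' (-smoothPhi₂ ((α : ℂ) + u * I) y) u :=
      (hasDerivAt_saddleExponentDeriv (hre u)).comp_ofReal
    have h2 : HasDerivAt (fun u : ℝ => ((φ * u : ℝ) : ℂ)) (φ : ℂ) u := by
      have h := ((hasDerivAt_id u).const_mul φ).ofReal_comp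
      refine h.congr_deriv ?_
      push_cast; simp
    have h3 : HasDerivAt (fun u : ℝ => ((Φ₃ / 2 * u ^ 2 : ℝ) : ℂ) * I) (((Φ₃ * u : ℝ) : ℂ) * I) u := by
      have h := (((hasDerivAt_pow 2 u).const_mul (Φ₃ / 2)).ofReal_comp).mul_const I
      refine h.congr_deriv ?_
      push_cast; ring
    exact (h1.add h2).sub h3
  have hK''d : ∀ u : ℝ, HasDerivAt K'' (K''' u) u := by
    intro u
    have h1 : HasDerivAt (fun u : ℝ => -smoothPhi₂ ((α : ℂ) + u * I) y)
        (smoothPhi₃ ((α : ℂ) + u * I) y * I) u :=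
      (hasDerivAt_neg_smoothPhi₂_line (hre u)).comp_ofReal
    have h2 : HasDerivAt (fun u : ℝ => ((Φ₃ * u : ℝ) : ℂ) * I) ((Φ₃ : ℂ) * I) u := by
      have h := (((hasDerivAt_id u).const_mul Φ₃).ofReal_comp).mul_const I
      refine h.congr_deriv ?_
      push_cast; simp
    exact (h1.add_const (φ : ℂ)).sub h2
  -- values at `0`
  have hK0 : K 0 = 0 := by simp [hK, he, saddleExponent_zero]
  have hK'0 : K' 0 = 0 := by simp [hK', he', hαdef, saddleExponentDeriv_zero hx hy]
  have hK''0 : K'' 0 = 0 := by simp [hK'', smoothPhi₂_ofReal, hφ]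
  -- `‖K'''(u)‖ ≤ |u| Φ₄`
  have hK'''b : ∀ u : ℝ, ‖K''' u‖ ≤ |u| * Φ₄ := by
    intro u
    calc ‖K''' u‖ = ‖smoothPhi₃ ((α : ℂ) + u * I) y - smoothPhi₃ α y‖ := by
          simp only [hK''']
          rw [smoothPhi₃_ofReal, ← sub_mul, norm_mul, Complex.norm_I, mul_one]
      _ ≤ |u| * Φ₄ := norm_smoothPhi₃_sub_le_mul_saddlePhi₄ hα0 u y
  -- three mean value inequalities on `uIcc 0 t`
  have hsub : ∀ u ∈ Set.uIcc (0 : ℝ) t, Set.uIcc (0 : ℝ) u ⊆ Set.uIcc 0 t := fun u hu =>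
    Set.uIcc_subset_uIcc Set.left_mem_uIcc hu
  have hK''b : ∀ u ∈ Set.uIcc (0 : ℝ) t, ‖K'' u‖ ≤ Φ₄ * t ^ 2 := by
    intro u hu
    have hb : ∀ v ∈ Set.uIcc (0 : ℝ) u, ‖K''' v‖ ≤ |t| * Φ₄ := fun v hv =>
      (hK'''b v).trans (mul_le_mul_of_nonneg_right (abs_le_abs_of_mem_uIcc (hsub u hu hv)) hΦ₄0)
    have h := (convex_uIcc (0 : ℝ) u).norm_image_sub_le_of_norm_hasDerivWithin_le
      (fun v _ => (hK''d v).hasDerivWithinAt) hb Set.left_mem_uIcc Set.right_mem_uIcc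
    rw [hK''0, sub_zero, sub_zero, Real.norm_eq_abs] at h
    calc ‖K'' u‖ ≤ |t| * Φ₄ * |u| := h
      _ ≤ |t| * Φ₄ * |t| := mul_le_mul_of_nonneg_left (abs_le_abs_of_mem_uIcc hu) (by positivity)
      _ = Φ₄ * |t| ^ 2 := by ring
      _ = Φ₄ * t ^ 2 := by rw [sq_abs]
  have hK'b : ∀ u ∈ Set.uIcc (0 : ℝ) t, ‖K' u‖ ≤ Φ₄ * t ^ 2 * |t| := by
    intro u hu
    have hb : ∀ v ∈ Set.uIcc (0 : ℝ) u, ‖K'' v‖ ≤ Φ₄ * t ^ 2 := fun v hv => hK''b v (hsub u hu hv)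
    have h := (convex_uIcc (0 : ℝ) u).norm_image_sub_le_of_norm_hasDerivWithin_le
      (fun v _ => (hK'd v).hasDerivWithinAt) hb Set.left_mem_uIcc Set.right_mem_uIcc
    rw [hK'0, sub_zero, sub_zero, Real.norm_eq_abs] at h
    calc ‖K' u‖ ≤ Φ₄ * t ^ 2 * |u| := h
      _ ≤ Φ₄ * t ^ 2 * |t| := mul_le_mul_of_nonneg_left (abs_le_abs_of_mem_uIcc hu) (by positivity)
  have h := (convex_uIcc (0 : ℝ) t).norm_image_sub_le_of_norm_hasDerivWithin_le
    (fun v _ => (hKd v).hasDerivWithinAt) hK'b Set.left_mem_uIcc Set.right_mem_uIcc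
  rw [hK0, sub_zero, sub_zero, Real.norm_eq_abs] at h
  calc ‖saddleExponent x α y t + ((φ / 2 * t ^ 2 : ℝ) : ℂ) - ((Φ₃ / 6 * t ^ 3 : ℝ) : ℂ) * I‖ = ‖K t‖ := rfl
    _ ≤ Φ₄ * t ^ 2 * |t| * |t| := h
    _ = Φ₄ * t ^ 2 * |t| ^ 2 := by ring
    _ = Φ₄ * t ^ 4 := by rw [sq_abs]; ring

/-! ### The window integral of the saddle integrand with a kernel -/

/-- `t ↦ exp(e(t)) A(t)` is continuous for a continuous kernel `A` (`α > 0`). [folklore] -/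
theorem continuous_exp_saddleExponent_mul (hα : 0 < α) (x : ℝ) (y : ℕ) {A : ℝ → ℂ} (hA : Continuous A) :
    Continuous fun t : ℝ => Complex.exp (saddleExponent x α y t) * A t := by
  have h1 : Continuous fun t : ℝ => Complex.exp (saddleExponent x α y t) := by
    refine Complex.continuous_exp.comp (continuous_iff_continuousAt.2 fun t => ?_)
    have hre : 0 < ((α : ℂ) + (t : ℂ) * I).re := by simp [hα]
    exact ((hasDerivAt_saddleExponent (x := x) (y := y) hre).comp_ofReal).continuousAt
  exact h1.mul hA

/-- **Hildebrand–Tenenbaum's Lemma 11, window part, at second order — uniformly in `x > 1`, `y ≥ 2`.**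
With `α = α(x, y)`, `φ = φ₂(α, y)`, `Φ₃ = -φ₃(α, y)`, `Φ₄ = φ₄(α, y)`, a continuous kernel `A` with
`‖A(t) - A₀ - A₁t‖ ≤ B₂t²` on `|t| ≤ τ`, and a window with `Φ₃τ³/6 + Φ₄τ⁴ ≤ 1`:
`‖∫_{[-τ,τ]} exp(e(t)) A(t) dt - A₀ √(2π/φ)‖ ≤ ‖A₀‖ e^{-φτ²/4} √(4π/φ)`
`+ √(4π/φ) (eB₂ · 4/(eφ) + (‖A₀‖Φ₄ + ‖A₁‖(Φ₃/3 + Φ₄)) (8/(eφ))² + (‖A₀‖Φ₃²/18 + ‖A₁‖Φ₄) (12/(eφ))³`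
`+ 2‖A₀‖Φ₄² (16/(eφ))⁴)`. [cite: HildebrandTenenbaum1986, Lemma 11 and §4 (4.5)–(4.8)] -/
theorem norm_setIntegral_window_saddle_sub_main_le {A : ℝ → ℂ} {A₀ A₁ : ℂ} {B₂ τ : ℝ}
    (hx : 1 < x) (hy : 2 ≤ y) (hτ : 0 ≤ τ) (hB₂ : 0 ≤ B₂) (hA : Continuous A)
    (hAexp : ∀ t ∈ Set.Icc (-τ) τ, ‖A t - A₀ - A₁ * t‖ ≤ B₂ * t ^ 2)
    (hsmall : saddlePhi₃ (saddlePoint x y) y / 6 * τ ^ 3 + saddlePhi₄ (saddlePoint x y) y * τ ^ 4 ≤ 1) :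
    ‖(∫ t in Set.Icc (-τ) τ, Complex.exp (saddleExponent x (saddlePoint x y) y t) * A t) -
        A₀ * ((Real.sqrt (2 * Real.pi / saddlePhi₂ (saddlePoint x y) y) : ℝ) : ℂ)‖ ≤
      ‖A₀‖ * (Real.exp (-(saddlePhi₂ (saddlePoint x y) y / 4) * τ ^ 2) *
          Real.sqrt (4 * Real.pi / saddlePhi₂ (saddlePoint x y) y)) +
        Real.sqrt (4 * Real.pi / saddlePhi₂ (saddlePoint x y) y) *
          (Real.exp 1 * B₂ * (4 * 1 / (Real.exp 1 * saddlePhi₂ (saddlePoint x y) y)) ^ 1 +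
            (‖A₀‖ * saddlePhi₄ (saddlePoint x y) y +
                ‖A₁‖ * (saddlePhi₃ (saddlePoint x y) y / 3 + saddlePhi₄ (saddlePoint x y) y)) *
              (4 * 2 / (Real.exp 1 * saddlePhi₂ (saddlePoint x y) y)) ^ 2 +
            (‖A₀‖ * saddlePhi₃ (saddlePoint x y) y ^ 2 / 18 + ‖A₁‖ * saddlePhi₄ (saddlePoint x y) y) *
              (4 * 3 / (Real.exp 1 * saddlePhi₂ (saddlePoint x y) y)) ^ 3 +
            2 * ‖A₀‖ * saddlePhi₄ (saddlePoint x y) y ^ 2 *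
              (4 * 4 / (Real.exp 1 * saddlePhi₂ (saddlePoint x y) y)) ^ 4) := by
  set α : ℝ := saddlePoint x y with hαdef
  have hα0 : 0 < α := saddlePoint_pos hx hy
  set φ : ℝ := saddlePhi₂ α y with hφ
  set Φ₃ : ℝ := saddlePhi₃ α y with hΦ₃
  set Φ₄ : ℝ := saddlePhi₄ α y with hΦ₄
  have hφ0 : 0 < φ := saddlePhi₂_pos hy hα0
  have hΦ₃0 : 0 ≤ Φ₃ := saddlePhi₃_nonneg hα0 y
  have hΦ₄0 : 0 ≤ Φ₄ := saddlePhi₄_nonneg hα0 y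
  set F : ℝ → ℂ := fun t => Complex.exp (saddleExponent x α y t) * A t with hF
  have hFc : Continuous F := continuous_exp_saddleExponent_mul hα0 x y hA
  have hFi : IntegrableOn F (Set.Icc (-τ) τ) := hFc.continuousOn.integrableOn_compact isCompact_Icc
  refine SaddleWindow.norm_setIntegral_window_sub_main_le (Φ₃ := Φ₃) (A₁ := A₁) hφ0 hτ (by positivity)
    (by positivity) (by positivity) (by positivity) hFi fun t ht => ?_
  have htabs : |t| ≤ τ := abs_le.2 ⟨ht.1, ht.2⟩
  have hsmall_t : Φ₃ / 6 * |t| ^ 3 + Φ₄ * t ^ 4 ≤ 1 := by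
    have h3 : |t| ^ 3 ≤ τ ^ 3 := pow_le_pow_left₀ (abs_nonneg t) htabs 3
    have h4 : t ^ 4 ≤ τ ^ 4 := by
      have := pow_le_pow_left₀ (abs_nonneg t) htabs 4
      rwa [(show Even 4 from ⟨2, rfl⟩).pow_abs] at this
    calc Φ₃ / 6 * |t| ^ 3 + Φ₄ * t ^ 4 ≤ Φ₃ / 6 * τ ^ 3 + Φ₄ * τ ^ 4 := by gcongr
      _ ≤ 1 := hsmall
  have hT : ‖saddleExponent x α y t + ((φ / 2 * t ^ 2 : ℝ) : ℂ) - ((Φ₃ / 6 * t ^ 3 : ℝ) : ℂ) * I‖ ≤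
      Φ₄ * t ^ 4 := norm_saddleExponent_taylor_four hx hy t
  exact SaddleWindow.norm_window_pointwise (g := fun u : ℝ => saddleExponent x α y u) hΦ₃0 hΦ₄0 hT
    hsmall_t (hAexp t ht)

end Literature.NumberTheory.Sieve
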